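import Summits.HodgeConjecture.CorCM.DihedralSexticPairCurveGenerators
import HarnessLib

/-!
# COR-CM — the Hodge conjecture for `E × B₀ × B₁` modulo Markman's fourfold theorem (`K = k·F₀` non-Galois sextic CM,
# `E` the CM curve of `k`, `B₀, B₁` Galois-conjugate non-isogenous simple CM threefolds of `K`), frame form

Cell `pub-hodgecm2` (COR-CM), seat b30 gen 14 (2026-08-21); COUNT-NEUTRAL; theorems only, no definition, no named fact,
no `sorry`.  Assembly of `CorCM/DihedralSexticPairCurveTransfer.lean` (transfer + census `Census/DihedralSexticPairCurve.lean`)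
and `CorCM/DihedralSexticPairCurveGenerators.lean` (the generating lines are algebraic modulo Markman):
`hodgeConjectureFor_biproduct_curveSlots_of_frame_of_markman` — for realisations `A₃ 0 ⊨ (k; {τ})`,
`A₃ (m+1) ⊨ (K; Φₘ)` read in a frame of `K ⊇ i(k)` (`Φₘ` of sign `true` exactly over the place `m`),
**`HodgeConjectureFor (⨁ A₃)`** — every rational `(p,p)`-class on the abelian sevenfold `E × B₀ × B₁` is algebraic —
GIVEN ONLY `Markman2025_weilClasses_algebraic_abelianFourfold`; and the `AVDominatedBy` form (its isogeny factors,
among them `E × B₀ × B₁`, `Bₘ × E`, `B₀ × B₁`).  HONEST FRAMING: conditional on Markman only; `HC_CM` is not asserted.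
[cite: Markman2025SurveySecant, Thm. 1.2] [cite: Pohlmann1968, Thm 1] [cite: GaoUllmo2025, Thm 3.1]
[cite: MoonenZarhin1999LowDim, Thm. 0.1 (the shape `B• = D• + Σ W`)]

## References
* [Markman2025SurveySecant] E. Markman, arXiv:2509.23403, Thm. 1.2.  [Pohlmann1968] Ann. of Math. 88, Thm 1.
  [GaoUllmo2025] J. Inst. Math. Jussieu 25, Thm 3.1.  [MoonenZarhin1999LowDim] Duke 98 (1999), Thm. 0.1.
-/

noncomputable section

open CategoryTheory CategoryTheory.Limits NumberField

namespace Summit.HodgeConjecture.CorCM.DihedralSexticPairCurve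

open Literature.AlgebraicGeometry Literature.AlgebraicGeometry.Motives Literature.AlgebraicGeometry.HodgeTheory
open Literature.AlgebraicGeometry.ComplexMultiplication (IsCMTypeRealisation)

variable {I : Type} {Kf : I → Type} [∀ i, Field (Kf i)] [∀ i, NumberField (Kf i)] [∀ i, IsCMField (Kf i)]
  {i₀ i₁ : I} {τ : Kf i₀ →+* ℂ}
  {A₃ : Fin 3 → AbelianVariety ℂ} {Φ₃ : ∀ j : Fin 3, CMType (Kf (curveSlots i₀ i₁ j))}
  {ι₃ : ∀ j, 𝓞 (Kf (curveSlots i₀ i₁ j)) →+* End (A₃ j)}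
  {θ₃ : ∀ j, Kf (curveSlots i₀ i₁ j) →+* Module.End ℂ (complexBetti (A₃ j).X 1)}

/-- **MAIN THEOREM (frame form).  The Hodge conjecture for `E × B₀ × B₁ = ⨁ A₃` modulo Markman's fourfold theorem.**
[cite: Markman2025SurveySecant, Thm. 1.2] [cite: Pohlmann1968, Thm 1] [cite: GaoUllmo2025, Thm 3.1]
[cite: MoonenZarhin1999LowDim, Thm. 0.1] -/
theorem hodgeConjectureFor_biproduct_curveSlots_of_frame_of_markman
    (hW4 : Markman2025_weilClasses_algebraic_abelianFourfold)
    (h6 : Module.finrank ℚ (Kf i₁) = 6) (h2 : Module.finrank ℚ (Kf i₀) = 2) (i : Kf i₀ →+* Kf i₁)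
    {δ : 𝓞 (Kf i₀)} {d : ℕ} (hd : 0 < d) (hδ : ((δ : Kf i₀)) ^ 2 = -(d : Kf i₀))
    (hτ : τ (δ : Kf i₀) = Complex.I * (Real.sqrt d : ℂ))
    (hA : ∀ j, IsCMTypeRealisation (Φ₃ j) (A₃ j) (ι₃ j) (θ₃ j))
    (e : (Kf i₁ →+* ℂ) ≃ ZMod 3 × Bool)
    (he_conj : ∀ s : Kf i₁ →+* ℂ, e (ComplexEmbedding.conjugate s) = ((e s).1, !(e s).2))
    (he_sign : ∀ s : Kf i₁ →+* ℂ, s.comp i = τ ↔ (e s).2 = true)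
    (he_gal : ∀ (j : ZMod 3) (f : Bool), ∃ σ : ℂ ≃+* ℂ, ∀ s : Kf i₁ →+* ℂ,
      e ((σ : ℂ →+* ℂ).comp s) = ((if f then -(e s).1 else (e s).1) + j, (e s).2))
    (hΨ : ∀ σ : Kf i₀ →+* ℂ, σ ∈ (Φ₃ 0).1 ↔ σ = τ)
    (hΦ : ∀ (m : Fin 2) (s : Kf i₁ →+* ℂ), s ∈ (Φ₃ m.succ).1 ↔ (e s).2 = decide ((e s).1.val = m.val)) :
    HodgeConjectureFor (⨁ A₃).dim (⨁ A₃).X :=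
  hodgeConjectureFor_biproduct_curveSlots_of_generators (CMThreefoldPair.conjugate_ne_of_apply_eq hd hτ)
    (fun σ => DihedralSexticPair.eq_or_eq_conjugate h2 hd hτ σ) hA he_conj he_sign he_gal hΨ hΦ
    (fun m b T hT => weightClassesAlg_le_algebraicClasses_of_image_eq_weil4 hW4 h6 h2 hd hδ hτ hA he_sign hΨ hΦ m b T hT)
    (fun b T hT => weightClassesAlg_le_algebraicClasses_of_image_eq_pair6 hW4 h6 h2 hd hδ hτ hA he_sign hΦ b T hT)

/-- **The Hodge conjecture for every abelian variety dominated by `E × B₀ × B₁`** (its isogeny factors), frame form,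
modulo Markman. [cite: Markman2025SurveySecant, Thm. 1.2] [cite: MumfordAV1970, §19] -/
theorem hodgeConjectureFor_of_avDominatedBy_curveSlots_of_frame_of_markman
    (hW4 : Markman2025_weilClasses_algebraic_abelianFourfold)
    (h6 : Module.finrank ℚ (Kf i₁) = 6) (h2 : Module.finrank ℚ (Kf i₀) = 2) (i : Kf i₀ →+* Kf i₁)
    {δ : 𝓞 (Kf i₀)} {d : ℕ} (hd : 0 < d) (hδ : ((δ : Kf i₀)) ^ 2 = -(d : Kf i₀))
    (hτ : τ (δ : Kf i₀) = Complex.I * (Real.sqrt d : ℂ))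
    (hA : ∀ j, IsCMTypeRealisation (Φ₃ j) (A₃ j) (ι₃ j) (θ₃ j))
    (e : (Kf i₁ →+* ℂ) ≃ ZMod 3 × Bool)
    (he_conj : ∀ s : Kf i₁ →+* ℂ, e (ComplexEmbedding.conjugate s) = ((e s).1, !(e s).2))
    (he_sign : ∀ s : Kf i₁ →+* ℂ, s.comp i = τ ↔ (e s).2 = true)
    (he_gal : ∀ (j : ZMod 3) (f : Bool), ∃ σ : ℂ ≃+* ℂ, ∀ s : Kf i₁ →+* ℂ,
      e ((σ : ℂ →+* ℂ).comp s) = ((if f then -(e s).1 else (e s).1) + j, (e s).2))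
    (hΨ : ∀ σ : Kf i₀ →+* ℂ, σ ∈ (Φ₃ 0).1 ↔ σ = τ)
    (hΦ : ∀ (m : Fin 2) (s : Kf i₁ →+* ℂ), s ∈ (Φ₃ m.succ).1 ↔ (e s).2 = decide ((e s).1.val = m.val))
    {B : AbelianVariety ℂ} (hB : Domination.AVDominatedBy B (⨁ A₃)) : HodgeConjectureFor B.dim B.X :=
  Domination.hodgeConjectureFor_of_avDominatedBy
    (hodgeConjectureFor_biproduct_curveSlots_of_frame_of_markman hW4 h6 h2 i hd hδ hτ hA e he_conj he_sign he_gal hΨ hΦ)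
    hB

end Summit.HodgeConjecture.CorCM.DihedralSexticPairCurve

end
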